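import Mathlib
import HarnessLib
import Summits.ValiantsHypothesis.ValiantsHypothesis.Theses.MonotoneRestoration
import Literature.Computability.AlgebraicComplexity.ArithCircuit
import Literature.Computability.AlgebraicComplexity.ArithCircuitProofs
import Literature.Computability.AlgebraicComplexity.MonotoneStructure
import Literature.Computability.AlgebraicComplexity.PermanentIrreducible
import Literature.ModelTheory.FiniteModelTheory.CkEquiv
import Summits.ValiantsHypothesis.ValiantsHypothesis.Theorems.MonotoneRestorationMonotoneRestorationQPCosetCount
import Summits.ValiantsHypothesis.ValiantsHypothesis.Theorems.MonotoneRestorationMonotoneRestorationQPSymmetricLB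
import Summits.ValiantsHypothesis.ValiantsHypothesis.Theorems.MonotoneRestorationMonotoneRestorationQPSupportSymmetrisation
import Summits.ValiantsHypothesis.ValiantsHypothesis.Theorems.MonotoneRestorationMonotoneRestorationQPSparseRegime
import Summits.ValiantsHypothesis.ValiantsHypothesis.Theorems.MonotoneRestorationMonotoneRestorationQPBeta
import Literature.Computability.AlgebraicComplexity.SymmetricArithCircuit
import Literature.Computability.AlgebraicComplexity.DawarWilsenach2025Proofs
import Literature.GroupTheory.PermutationGroups.SmallIndexSubgroups
import Summits.ValiantsHypothesis.ValiantsHypothesis.Theorems.MonotoneRestorationQP.Negative.LoadBearing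
import Summits.ValiantsHypothesis.ValiantsHypothesis.Theorems.MonotoneRestorationMonotoneRestorationQPPermSupportCount
import Summits.ValiantsHypothesis.ValiantsHypothesis.Theorems.MonotoneRestorationMonotoneRestorationQPVariants18952

/-! TTRL-lite variant V19875 of stmt-ValiantsHypothesis-15886 -/

-- `ValiantsHypothesis.ValiantsHypothesis`: the D-0017 layout repeats the problem name in the path.
set_option linter.dupNamespace false

namespace Summit.ValiantsHypothesis.ValiantsHypothesis.Theorems

open Summit.ValiantsHypothesis.ValiantsHypothesis.Theses.MonotoneRestoration
open Literature.Computability.AlgebraicComplexity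

/-- **Fan-in budget at a multiplication gate** (TTRL-lite variant V19875 of
`stub_mulGate_children_extend`, stmt-ValiantsHypothesis-15886). Over `ℝ≥0` nothing cancels: if
`P` is a `×`-gate with `eval P ≠ 0` whose monomials extend, by a common shift `μ`, to monomials
of `f`, then the number of *non-constant* children of `P` (children `h` with
`1 ≤ totalDegree (eval h)`) is at most `totalDegree f`.
Proof: each non-constant child contributes at least `1` to
`∑ h ∈ children P, totalDegree (eval h)`, and that sum is `≤ totalDegree f` by the landed full
degree budget `stub_mulGate_children_extend_var18952`. [folklore] -/
theorem stub_mulGate_children_extend_var19875 :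
    ∀ (n : ℕ) (G : Type) (C : LabelledArithCircuit NNReal (Fin n × Fin n) Unit G)
      (f : MvPolynomial (Fin n × Fin n) NNReal) (P : G), C.label P = .mul → C.eval P ≠ 0 →
      (∃ μ : (Fin n × Fin n) →₀ ℕ, ∀ m ∈ (C.eval P).support, m + μ ∈ f.support) →
      ((C.children P).filter (fun h => 1 ≤ (C.eval h).totalDegree)).card ≤ f.totalDegree := by
  intro n G C f P hP hP0 hext
  have hsum := stub_mulGate_children_extend_var18952 n G C f P hP hP0 hext
  calc ((C.children P).filter (fun h => 1 ≤ (C.eval h).totalDegree)).card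
      = ∑ h ∈ (C.children P).filter (fun h => 1 ≤ (C.eval h).totalDegree), 1 :=
        Finset.card_eq_sum_ones _
    _ ≤ ∑ h ∈ (C.children P).filter (fun h => 1 ≤ (C.eval h).totalDegree),
          (C.eval h).totalDegree :=
        Finset.sum_le_sum fun h hh => (Finset.mem_filter.1 hh).2
    _ ≤ ∑ h ∈ C.children P, (C.eval h).totalDegree :=
        Finset.sum_le_sum_of_subset_of_nonneg (Finset.filter_subset _ _)
          fun _ _ _ => Nat.zero_le _
    _ ≤ f.totalDegree := hsum

end Summit.ValiantsHypothesis.ValiantsHypothesis.Theorems
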